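import Literature.AlgebraicGeometry.HodgeTheory.AlgebraicClasses
import Literature.AlgebraicGeometry.Motives.VarietiesProperProofs
import Literature.AlgebraicGeometry.Motives.CyclesDimensionProofs
import Literature.NumberTheory.Transcendental.AnalytificationChartsProofs
import Literature.NumberTheory.Transcendental.AnalytificationSeparatedProofs
import Literature.NumberTheory.Transcendental.AnalytificationConnectedProofs
import Literature.AlgebraicTopology.SingularHomology.NoncompactManifoldProofs
import Literature.AlgebraicTopology.SingularHomology.UniversalCoefficientsField
import Literature.AlgebraicTopology.Homotopy.HomotopyGroupsGeneralPosition
import Mathlib.Analysis.InnerProductSpace.PiL2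
import Mathlib.Topology.Algebra.Module.FiniteDimension
import HarnessLib

/-!
# Top-degree classes are algebraic: `H²ⁿ(X(ℂ); ℂ) = Nⁿ H²ⁿ(X(ℂ); ℂ)` (the class of a point)

Family `hodge`, layer `Literature/AlgebraicGeometry/HodgeTheory`. For `X` smooth projective of
dimension `n ≥ 1` over `ℂ`, EVERY class `c ∈ H²ⁿ(X(ℂ); ℂ)` is algebraic, i.e. lies in
`algebraicClasses X n = Nⁿ H²ⁿ(X(ℂ); ℂ)` (file `AlgebraicClasses`): `c` vanishes on `(X ∖ {x})(ℂ)` for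
any closed point `x ∈ X`, a Zariski-closed subset of codimension `n`. This is the degree-`2 dim X`
case of the Hodge conjecture ("`H²ⁿ(X, ℤ) = ℤ · [pt]`": Voisin I, §11.1.2 and Thm. 7.14 for `ℙⁿ`;
Deligne 2000, §1), one of the implicit degrees of "as `X'` is of dimension `≤ 3`, the rational Hodge
conjecture holds for `X̃'` in every degree" (Voisin II, proof of Prop. 10.26). ALL PROVED, by
assembling results of the tree:

1. `(X ∖ {x})(ℂ) = X(ℂ) ∖ {P}` for the unique complex point `P` over the closed point `x = P.pt`
   (complex points ↔ closed points, `ComplexPoints.equivClosedPoints`, Nullstellensatz), and `x` has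
   codimension `n` (`Motives.height_add_coheight_eq_of_smoothOfRelativeDimension`: `dim + codim = n` on
   the smooth irreducible `X`, Hartshorne II Ex. 3.20; a closed point has `height 0`).
2. `X(ℂ)` is a compact, Hausdorff, connected topological `2n`-manifold: holomorphic algebraic charts
   `X(ℂ) ⇀ ℂⁿ ≃ₜ ℝ²ⁿ` (`Literature.NumberTheory.Transcendental.exists_algebraicChart_holds`, Serre GAGA
   §2 n°5–6, as in `Motives.bettiCohomologyInt_finite_holds`), compact since `X` is proper
   (`Motives.compactSpace_algPoints_of_isProper_holds`), Hausdorff since `X` is separated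
   (`ComplexPoints.t2Space_of_isSeparated`), connected since `X` is irreducible
   (`ComplexPoints.isConnected_setOf_pt_mem_of_isIrreducible_holds`, SGA1 XII Prop. 2.4 /
   Shafarevich VII §2 Thm. 7.1).
3. Hence `X(ℂ) ∖ {P}` is a connected (`2n ≥ 2`: removing a point keeps a manifold path connected,
   `Literature.AlgebraicTopology.Homotopy.isPathConnected_compl_singleton_of_chartedSpace`) NON-compact
   (a compact open subset of the Hausdorff `X(ℂ)` would be closed, making `P` isolated, impossible in
   a manifold of positive dimension) `2n`-manifold, so `H₂ₙ(X(ℂ) ∖ {P}; ℂ) = 0` (Hatcher Prop. 3.29,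
   PROVED in the tree: `isZero_singularHomology_of_noncompactSpace_holds`) and
   `H²ⁿ(X(ℂ) ∖ {P}; ℂ) ↪ Hom(H₂ₙ, ℂ) = 0` (universal coefficients over a field, Hatcher Thm. 3.2,
   PROVED: `kroneckerPairing_injective_of_field`).
4. So the restriction of `c` to `(X ∖ {x})(ℂ)` vanishes and `c ∈ Nⁿ H²ⁿ`
   (`mem_supportedClasses_of_restrictCompl_eq_zero`).

Consumer: the assembly of `hodgeClasses_algebraic_of_dim_le_three`
(`hodgeClasses_algebraic_of_dim_le_three_of`, file `HodgeClassesDimLEThreeProofs`), degrees `2p = 2n`,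
`n = 2, 3`.

## References

* [HatcherAT2002] A. Hatcher, Algebraic Topology (CUP 2002), §3.3 Prop. 3.29, §3.1 Thm. 3.2.
* [VoisinHodgeI2002] C. Voisin, Hodge Theory and Complex Algebraic Geometry I (CUP 2002), §11.1.2,
  Thm. 7.14.
* [VoisinHodgeII2003] C. Voisin, Hodge Theory and Complex Algebraic Geometry II (CUP 2003), §10.2.3
  proof of Prop. 10.26.
* [SerreGAGA1956] J.-P. Serre, GAGA, Ann. Inst. Fourier 6 (1956), §2.
* [Hartshorne1977] R. Hartshorne, Algebraic Geometry (1977), II Ex. 3.20.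
-/

noncomputable section

open CategoryTheory AlgebraicGeometry Topology Filter

namespace Literature.AlgebraicGeometry.HodgeTheory

section HodgeTheory

open Literature.AlgebraicTopology.SingularHomology Literature.AlgebraicGeometry.Motives

variable {n : ℕ} {X : Motives.SchemeOver ℂ}

/-! ### Closed points: codimension and the punctured space of complex points -/

/-- A complex point `P` of a scheme over `ℂ` lies over a point `P.pt` which is minimal for the
specialisation order (`P.pt` is a closed point, `ComplexPoints.isClosed_pt`), i.e. has `height 0`.
[folklore] -/
theorem height_pt_eq_zero (P : ComplexPoints X) : Order.height P.pt = 0 := by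
  rw [Order.height_eq_zero]
  intro y hy
  have hy' : P.pt ⤳ y := Scheme.le_iff_specializes.1 hy
  have hmem : y ∈ ({P.pt} : Set X.left) := by
    rw [← (ComplexPoints.isClosed_pt P).closure_eq]
    exact hy'.mem_closure
  rw [Set.mem_singleton_iff.1 hmem]

/-- **A closed point of a smooth projective `n`-fold has codimension `n`**: for a complex point `P` of
`X` smooth projective of dimension `n` over `ℂ`, `coheight P.pt = n` (`dim {x}⁻ + codim {x}⁻ = n` on
the smooth irreducible `X`, Hartshorne II Ex. 3.20 (d), the tree's
`Motives.height_add_coheight_eq_of_smoothOfRelativeDimension`, with `height P.pt = 0`).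
[cite: Hartshorne1977, II Ex. 3.20 (d)] -/
theorem coheight_pt_eq (hX : IsSmoothProjective n X) (P : ComplexPoints X) :
    Order.coheight P.pt = n := by
  haveI := hX.smoothOfRelativeDimension
  haveI := hX.geometricallyIrreducible
  haveI : IrreducibleSpace ↥X.left := GeometricallyIrreducible.irreducibleSpace_of_subsingleton X.hom
  have h := Motives.height_add_coheight_eq_of_smoothOfRelativeDimension X.hom n P.pt
  rwa [height_pt_eq_zero P, zero_add] at h

/-- The complex points of `X ∖ {P.pt}` are the complex points of `X` other than `P` (complex points
of a scheme locally of finite type over `ℂ` correspond bijectively to closed points,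
`ComplexPoints.equivClosedPoints`). [folklore] -/
theorem setOf_pt_notMem_singleton_eq [LocallyOfFiniteType X.hom] (P : ComplexPoints X) :
    {Q : ComplexPoints X | Q.pt ∉ ({P.pt} : Set X.left)} = {P}ᶜ := by
  ext Q
  simp only [Set.mem_setOf_eq, Set.mem_singleton_iff, Set.mem_compl_iff]
  refine not_congr ⟨fun h ↦ (ComplexPoints.equivClosedPoints X).injective (Subtype.ext ?_), fun h ↦ by rw [h]⟩
  rw [ComplexPoints.coe_equivClosedPoints_apply, ComplexPoints.coe_equivClosedPoints_apply, h]

/-! ### `X(ℂ)` minus a point is a connected non-compact `2n`-manifold -/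

/-- `X(ℂ)` is connected for `X` smooth projective (irreducible varieties are connected in the complex
topology: SGA1 XII Prop. 2.4, Shafarevich VII §2 Thm. 7.1; the tree's
`ComplexPoints.isConnected_setOf_pt_mem_of_isIrreducible_holds` with `Z = X`).
[cite: SGA1, Exp. XII Prop. 2.4] -/
theorem connectedSpace_complexPoints (hX : IsSmoothProjective n X) : ConnectedSpace (ComplexPoints X) := by
  haveI : IsProper X.hom := IsSmoothProjective.isProper_holds hX
  haveI := hX.geometricallyIrreducible
  haveI : IrreducibleSpace ↥X.left := GeometricallyIrreducible.irreducibleSpace_of_subsingleton X.hom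
  have h := ComplexPoints.isConnected_setOf_pt_mem_of_isIrreducible_holds X isClosed_univ
    (IrreducibleSpace.isIrreducible_univ (X := ↥X.left))
  rw [connectedSpace_iff_univ]
  convert h using 1
  ext P
  simp

/-- In a space charted on `ℝᵈ`, `d ≥ 1`, no point is open (its image under a chart would be an open
point of `ℝᵈ`). [folklore] -/
theorem not_isOpen_singleton_of_chartedSpace {d : ℕ} (hd : 1 ≤ d) {M : Type*} [TopologicalSpace M]
    [ChartedSpace (EuclideanSpace ℝ (Fin d)) M] (P : M) : ¬ IsOpen ({P} : Set M) := by
  intro hP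
  haveI : Nontrivial (EuclideanSpace ℝ (Fin d)) :=
    Module.nontrivial_of_finrank_pos (R := ℝ) (by rw [finrank_euclideanSpace_fin]; omega)
  set e := chartAt (EuclideanSpace ℝ (Fin d)) P
  have himg : IsOpen (e '' {P}) :=
    e.isOpen_image_of_subset_source hP (Set.singleton_subset_iff.2 (mem_chart_source _ P))
  rw [Set.image_singleton, isOpen_singleton_iff_punctured_nhds] at himg
  exact (inferInstance : NeBot (𝓝[≠] (e P))).ne himg

/-- **The restriction `H²ⁿ(X(ℂ); ℂ) → H²ⁿ((X ∖ {x})(ℂ); ℂ)` is zero** for `X` smooth projective of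
dimension `n ≥ 1` over `ℂ` and `x = P.pt` a closed point: `(X ∖ {x})(ℂ) = X(ℂ) ∖ {P}` is a connected
non-compact `2n`-manifold, so `H₂ₙ(X(ℂ) ∖ {P}; ℂ) = 0` (Hatcher Prop. 3.29) and
`H²ⁿ(X(ℂ) ∖ {P}; ℂ) ≅ Hom(H₂ₙ, ℂ) = 0` (Hatcher Thm. 3.2 over a field).
[cite: HatcherAT2002, §3.3 Prop. 3.29 and §3.1 Thm. 3.2] -/
theorem restrictCompl_pt_eq_zero (hX : IsSmoothProjective n X) (hn : 1 ≤ n) (P : ComplexPoints X)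
    (c : complexBetti X (2 * n)) : complexBetti.restrictCompl X {P.pt} (2 * n) c = 0 := by
  haveI : IsProper X.hom := IsSmoothProjective.isProper_holds hX
  haveI := hX.smoothOfRelativeDimension
  haveI : CompactSpace (ComplexPoints X) := compactSpace_algPoints_of_isProper_holds X ℂ
  haveI : T2Space (ComplexPoints X) := ComplexPoints.t2Space_of_isSeparated X
  haveI : ConnectedSpace (ComplexPoints X) := connectedSpace_complexPoints hX
  -- `X(ℂ)` as a topological `2n`-manifold: algebraic charts followed by `ℂⁿ ≃ₜ ℝ²ⁿ`
  -- (Serre, GAGA §2 n°5 Prop. 2; as in `Motives.bettiCohomologyInt_finite_holds`)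
  choose chart mem _ using fun Q : ComplexPoints X ↦
    Literature.NumberTheory.Transcendental.exists_algebraicChart_holds X n Q
  let eC : (Fin n → ℂ) ≃ₜ EuclideanSpace ℝ (Fin (2 * n)) :=
    (ContinuousLinearEquiv.ofFinrankEq (𝕜 := ℝ) (by
      rw [Module.finrank_pi_fintype, finrank_euclideanSpace_fin]
      simp [Complex.finrank_real_complex, mul_comm])).toHomeomorph
  letI : ChartedSpace (EuclideanSpace ℝ (Fin (2 * n))) (ComplexPoints X) :=
    { atlas := Set.range fun Q ↦ (chart Q).transHomeomorph eC
      chartAt := fun Q ↦ (chart Q).transHomeomorph eC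
      mem_chart_source := fun Q ↦ by
        rw [OpenPartialHomeomorph.transHomeomorph_source]; exact mem Q
      chart_mem_atlas := fun Q ↦ ⟨Q, rfl⟩ }
  haveI : LocallyPathConnectedSpace (ComplexPoints X) :=
    ChartedSpace.locallyPathConnectedSpace (H := EuclideanSpace ℝ (Fin (2 * n))) (M := ComplexPoints X)
  haveI : PathConnectedSpace (ComplexPoints X) := pathConnectedSpace_iff_connectedSpace.2 inferInstance
  -- the open subset `U = X(ℂ) ∖ {P} = (X ∖ {P.pt})(ℂ)`
  let U : TopologicalSpace.Opens (ComplexPoints X) :=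
    ⟨{Q : ComplexPoints X | Q.pt ∉ ({P.pt} : Set X.left)}, by
      rw [setOf_pt_notMem_singleton_eq P]; exact isOpen_compl_singleton⟩
  have hU : (U : Set (ComplexPoints X)) = {P}ᶜ := setOf_pt_notMem_singleton_eq P
  -- `U` is a connected `2n`-manifold (`2n ≥ 2`)
  haveI : ConnectedSpace U := by
    have hpc : IsPathConnected ({P}ᶜ : Set (ComplexPoints X)) :=
      Literature.AlgebraicTopology.Homotopy.isPathConnected_compl_singleton_of_chartedSpace
        (E := EuclideanSpace ℝ (Fin (2 * n))) (by rw [finrank_euclideanSpace_fin]; omega) P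
    rw [← hU] at hpc
    exact isConnected_iff_connectedSpace.1 hpc.isConnected
  -- `U` is not compact: otherwise it would be closed and `P` isolated
  haveI : NoncompactSpace U := by
    rw [← not_compactSpace_iff]
    intro hc
    have hcpt : IsCompact (U : Set (ComplexPoints X)) := isCompact_iff_compactSpace.2 hc
    have hclosed : IsClosed ({P}ᶜ : Set (ComplexPoints X)) := hU ▸ hcpt.isClosed
    have hopen : IsOpen ({P} : Set (ComplexPoints X)) := isClosed_compl_iff.1 hclosed
    exact not_isOpen_singleton_of_chartedSpace (d := 2 * n) (by omega) P hopen
  -- Hatcher Prop. 3.29 and universal coefficients over `ℂ`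
  have h0 : Limits.IsZero (singularHomology ℂ ℂ U (2 * n)) :=
    isZero_singularHomology_of_noncompactSpace_holds ℂ U (2 * n) le_rfl
  haveI := ModuleCat.subsingleton_of_isZero h0
  haveI : Subsingleton (singularCohomology ℂ ℂ U (2 * n)) :=
    (kroneckerPairing_injective_of_field ℂ U (2 * n)).subsingleton
  have hsub : Subsingleton (singularCohomology ℂ ℂ (complexPointsCompl X {P.pt}) (2 * n)) := ‹_›
  exact Subsingleton.elim _ _

/-- **Every class of top degree is algebraic**: for `X` smooth projective of dimension `n ≥ 1` over
`ℂ`, `H²ⁿ(X(ℂ); ℂ) = Nⁿ H²ⁿ(X(ℂ); ℂ) = algebraicClasses X n` — every class vanishes off the closed point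
`P.pt` (`restrictCompl_pt_eq_zero`), a Zariski-closed subset of codimension `n` (`coheight_pt_eq`). This
is the degree `2 dim X` of the Hodge conjecture (`H²ⁿ(X, ℚ) = ℚ · [pt]`), with no rationality or
Hodge-type hypothesis needed. [cite: VoisinHodgeII2003, §10.2.3 proof of Prop. 10.26]
[cite: VoisinHodgeI2002, §11.1.2] [cite: HatcherAT2002, §3.3 Prop. 3.29] -/
theorem mem_algebraicClasses_of_degree_top (hX : IsSmoothProjective n X) (hn : 1 ≤ n)
    (c : complexBetti X (2 * n)) : c ∈ algebraicClasses X n := by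
  haveI : IsProper X.hom := IsSmoothProjective.isProper_holds hX
  haveI := hX.geometricallyIrreducible
  haveI : IrreducibleSpace ↥X.left := GeometricallyIrreducible.irreducibleSpace_of_subsingleton X.hom
  obtain ⟨P, -⟩ := ComplexPoints.exists_pt_mem (X := X) (Z := Set.univ) Set.univ_nonempty
    isClosed_univ.isLocallyClosed
  refine mem_supportedClasses_of_restrictCompl_eq_zero (ComplexPoints.isClosed_pt P) (fun z hz ↦ ?_)
    (restrictCompl_pt_eq_zero hX hn P c)
  rw [Set.mem_singleton_iff.1 hz, coheight_pt_eq hX P]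

end HodgeTheory

end Literature.AlgebraicGeometry.HodgeTheory

end
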